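import Mathlib
import Literature.Analysis.FluidPDE.CurlIsometryCovariance
import Literature.Analysis.FluidPDE.TaoAveragedNondegeneracy
import Summits.NavierStokesRegularity.NavierStokesRegularity.Theorems.ThreadingFluxHorizonTowerDefs
import HarnessLib

/-!
# Crux `PoloidalLiouville` (stmt-NavierStokesRegularity-1222, wall W1), crux idea «horizon-threading-tower» (ns-idea-15):
# the table cell `HorizonL2Zonal` BY NAME, for every degree, by REFLECTION PARITY

Support file (Theorems-side tooling; seat ns-wall-eng-7 g4, cell ns-wall-extremal, W1 adjunct; `--supports
stmt-NavierStokesRegularity-1222 --as helper`).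

`HorizonTower.HorizonL2Zonal` (table cell (S) of `ThreadingFluxHorizonTowerDefs.lean`): for every `l ≥ 2`, every axis
`a ≠ 0` and every profile `g`, the zonal degree-`l` function `H(z) = ‖z‖^l g(⟪a,z⟫/‖z‖)` has horizon profile
`U_H = curl curl (r^{1-l} H y)` annihilated by the order-two horizon law: `𝔏₂[U_H](x) = 0` for `x ≠ 0`.

The proof is STRUCTURAL (no closed-form law, no smoothness, no harmonicity is used): fix `x` and let `S` be the mirror
across a plane containing the axis `a` and the point `x` (unit normal `n ⊥ a, x`).  Call a field `V` *even* if
`V (S y) = S (V y)` and *odd* if `V (S y) = - S (V y)`.  Then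

* `cross (S u) (S v) = - S (cross u v)` (a mirror reverses orientation), so even × odd is even (`cross_mirror`);
* the curl of an even field is odd and the curl of an odd field is even (`curl_mirror_of_even`, `curl_mirror_of_odd`) —
  from the tree's pseudo-vector law `curl_conj_linearIsometryEquiv` (unconditional: `fderiv` of a composite with a linear
  isometry needs no differentiability, so the junk value `0` of `curl` is parity-consistent) and `det S = -1`;
* `F = (r^{1-l} H) y` is even (the axis is fixed by `S`), hence `curl F` odd, `U = curl curl F` even, `Ω = curl U` odd,
  `U × Ω` even, `(U × Ω) × Ω` even, its curl odd, `curl (U × Ω)` odd, `U × curl (U × Ω)` even, its curl odd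
  (`horizonProfile_mirror_even`, `horizonL2_eq_zero_of_mirror_even`);
* at the mirror-fixed point `x` an odd field `W` has `S (W x) = - W x`, so `⟪x, W x⟫ = ⟪S x, S (W x)⟫ = -⟪x, W x⟫ = 0`.

Main statement: ★ `HorizonTower.horizonL2Zonal : HorizonL2Zonal` — completes the TABLE of the Defs file by name
(`horizonL2Quadrupole` p673251, `horizonL2Tetrahedral` p673002, `horizonL2Octahedral` p674207, this file).

HONEST LABEL: a symmetry lemma about typed objects of one crux idea (axisymmetric-without-swirl far fields never thread);
`HorizonZonalitySingleDegree` (l ≥ 4), `HorizonTowerZonality`, `PoloidalLiouville` (1222), `UnthreadedRigidity` (27585) and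
NS regularity remain OPEN and untouched; information-grade for W1/W2 (movement 0).
[cite: ArfkenWeber1995, §2.9 eq. (2.90), (2.97)–(2.99)] [cite: MajdaBertozziCUP2002, §1.1 (vector identities)]
-/

-- the summit and its single problem share the name (D-0017 nested layout)
set_option linter.dupNamespace false

noncomputable section

open Set Function Module
open scoped RealInnerProductSpace
open Literature.Analysis.FluidPDE

namespace Summit.NavierStokesRegularity.NavierStokesRegularity.Theorems.PoloidalLiouville.HorizonTower

/-! ### The mirror `S = ((ℝ ∙ n)ᗮ).reflection` across the plane `n^⊥` (unit `n`) -/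

section Mirror

variable {n : E3}

/-- A unit vector is non-zero. -/
private theorem ne_zero_of_norm_eq_one' (hn : ‖n‖ = 1) : n ≠ 0 := by
  intro h
  rw [h, norm_zero] at hn
  exact zero_ne_one hn

/-- The mirror image `S v = v − 2⟪n, v⟫ n` across the plane `n^⊥` (unit `n`), as Mathlib's `((ℝ ∙ n)ᗮ).reflection`. -/
theorem mirror_apply (hn : ‖n‖ = 1) (v : E3) : (ℝ ∙ n)ᗮ.reflection v = v - (2 * ⟪n, v⟫) • n := by
  rw [Submodule.reflection_orthogonal_apply, Submodule.reflection_singleton_apply, hn]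
  simp only [RCLike.ofReal_real_eq_id, id_eq, one_pow, div_one, neg_sub]
  module

/-- Coordinates of the mirror image: `(S v)ᵢ = vᵢ − 2 ⟪n, v⟫ nᵢ` (unit `n`). -/
theorem mirror_apply_coord (hn : ‖n‖ = 1) (v : E3) (i : Fin 3) :
    (ℝ ∙ n)ᗮ.reflection v i = v i - 2 * (n 0 * v 0 + n 1 * v 1 + n 2 * v 2) * n i := by
  rw [mirror_apply hn v, PiLp.sub_apply, PiLp.smul_apply, smul_eq_mul, Tao2016.real_inner_fin3]

/-- The mirror fixes the vectors of its plane: `⟪n, v⟫ = 0 → S v = v`. -/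
theorem mirror_apply_of_inner_eq_zero (hn : ‖n‖ = 1) {v : E3} (hv : ⟪n, v⟫ = 0) :
    (ℝ ∙ n)ᗮ.reflection v = v := by
  rw [mirror_apply hn v, hv, mul_zero, zero_smul, sub_zero]

/-- The mirror has determinant `-1`. -/
theorem det_mirror (hn : ‖n‖ = 1) : ((ℝ ∙ n)ᗮ.reflection : E3 →L[ℝ] E3).det = -1 := by
  have h := ((ℝ ∙ n)ᗮ).det_reflection
  rw [Submodule.orthogonal_orthogonal, finrank_span_singleton (ne_zero_of_norm_eq_one' hn),
    pow_one] at h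
  exact h

/-- **A mirror reverses orientation**: `S u × S v = − S (u × v)` (unit normal `n`). -/
theorem cross_mirror (hn : ‖n‖ = 1) (u v : E3) :
    cross ((ℝ ∙ n)ᗮ.reflection u) ((ℝ ∙ n)ᗮ.reflection v) = -(ℝ ∙ n)ᗮ.reflection (cross u v) := by
  have hn' : n 0 ^ 2 + n 1 ^ 2 + n 2 ^ 2 = 1 := by
    have h := EuclideanSpace.real_norm_sq_eq n
    rw [hn, Fin.sum_univ_three] at h
    linarith
  ext i
  fin_cases i
  · simp only [Fin.zero_eta, Fin.isValue, PiLp.neg_apply, Tao2016.cross_apply_zero, mirror_apply_coord hn,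
      Tao2016.cross_apply_one, Tao2016.cross_apply_two]
    linear_combination (-2 * (u 1 * v 2 - u 2 * v 1)) * hn'
  · simp only [Fin.mk_one, Fin.isValue, PiLp.neg_apply, Tao2016.cross_apply_one, mirror_apply_coord hn,
      Tao2016.cross_apply_zero, Tao2016.cross_apply_two]
    linear_combination (2 * (u 0 * v 2 - u 2 * v 0)) * hn'
  · simp only [Fin.reduceFinMk, Fin.isValue, PiLp.neg_apply, Tao2016.cross_apply_two, mirror_apply_coord hn,
      Tao2016.cross_apply_zero, Tao2016.cross_apply_one]
    linear_combination (-2 * (u 0 * v 1 - u 1 * v 0)) * hn'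

/-- `u × (−v) = −(u × v)` (helper). -/
private theorem cross_neg_right' (u v : E3) : cross u (-v) = -cross u v := by
  ext i
  fin_cases i <;> (simp [cross, cross_apply]; try ring)

/-- **Even × odd is even**: if `V` is mirror-even and `W` mirror-odd then `V × W` is mirror-even. -/
theorem cross_mirror_even_odd (hn : ‖n‖ = 1) {V W : E3 → E3}
    (hV : ∀ y, V ((ℝ ∙ n)ᗮ.reflection y) = (ℝ ∙ n)ᗮ.reflection (V y))
    (hW : ∀ y, W ((ℝ ∙ n)ᗮ.reflection y) = -(ℝ ∙ n)ᗮ.reflection (W y)) (y : E3) :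
    cross (V ((ℝ ∙ n)ᗮ.reflection y)) (W ((ℝ ∙ n)ᗮ.reflection y))
      = (ℝ ∙ n)ᗮ.reflection (cross (V y) (W y)) := by
  rw [hV, hW, cross_neg_right', cross_mirror hn, neg_neg]

/-- **The curl of a mirror-even field is mirror-odd** (pseudo-vector law, `det S = −1`; no differentiability needed). -/
theorem curl_mirror_of_even (hn : ‖n‖ = 1) {V : E3 → E3}
    (hV : ∀ y, V ((ℝ ∙ n)ᗮ.reflection y) = (ℝ ∙ n)ᗮ.reflection (V y)) (x : E3) :
    curl V ((ℝ ∙ n)ᗮ.reflection x) = -(ℝ ∙ n)ᗮ.reflection (curl V x) := by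
  have key := curl_conj_linearIsometryEquiv (ℝ ∙ n)ᗮ.reflection V ((ℝ ∙ n)ᗮ.reflection x)
  have hfun : (fun y => (ℝ ∙ n)ᗮ.reflection (V ((ℝ ∙ n)ᗮ.reflection.symm y))) = V := by
    funext y
    rw [Submodule.reflection_symm, hV, Submodule.reflection_reflection]
  rw [hfun, LinearIsometryEquiv.symm_apply_apply, det_mirror hn, neg_smul, one_smul] at key
  exact key

/-- **The curl of a mirror-odd field is mirror-even.** -/
theorem curl_mirror_of_odd (hn : ‖n‖ = 1) {V : E3 → E3}
    (hV : ∀ y, V ((ℝ ∙ n)ᗮ.reflection y) = -(ℝ ∙ n)ᗮ.reflection (V y)) (x : E3) :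
    curl V ((ℝ ∙ n)ᗮ.reflection x) = (ℝ ∙ n)ᗮ.reflection (curl V x) := by
  have key := curl_conj_linearIsometryEquiv (ℝ ∙ n)ᗮ.reflection (fun y => -V y) ((ℝ ∙ n)ᗮ.reflection x)
  have hfun : (fun y => (ℝ ∙ n)ᗮ.reflection (-V ((ℝ ∙ n)ᗮ.reflection.symm y))) = V := by
    funext y
    rw [Submodule.reflection_symm, hV, neg_neg, Submodule.reflection_reflection]
  have hneg : curl (fun y => -V y) x = -curl V x := by
    rw [curl_eq_curlCLM, curl_eq_curlCLM, show (fun y => -V y) = -V from rfl, fderiv_neg, map_neg]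
  rw [hfun, LinearIsometryEquiv.symm_apply_apply, det_mirror hn, hneg, map_neg, neg_smul, one_smul,
    neg_neg] at key
  exact key

/-- At a point of the mirror plane, a mirror-odd field is tangent-free in the `x` direction: `⟪x, W x⟫ = 0`. -/
theorem inner_eq_zero_of_mirror_odd_at {x w : E3} (hx : (ℝ ∙ n)ᗮ.reflection x = x)
    (hw : (ℝ ∙ n)ᗮ.reflection w = -w) : ⟪x, w⟫ = 0 := by
  have h : ⟪x, w⟫ = -⟪x, w⟫ := by
    calc ⟪x, w⟫ = ⟪(ℝ ∙ n)ᗮ.reflection x, (ℝ ∙ n)ᗮ.reflection w⟫ :=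
          ((ℝ ∙ n)ᗮ.reflection.inner_map_map x w).symm
      _ = -⟪x, w⟫ := by rw [hx, hw, inner_neg_right]
  linarith

end Mirror

/-! ### Parity of the horizon profile and of the order-two horizon law -/

section Parity

variable {n : E3}

/-- **The horizon profile of a mirror-invariant scalar is mirror-even**: if `H (S y) = H y` then
`U = horizonProfile l H 0 = curl curl ((r^{1-l} H) y)` satisfies `U (S y) = S (U y)`. -/
theorem horizonProfile_mirror_even (hn : ‖n‖ = 1) {l : ℕ} {H : E3 → ℝ}
    (hH : ∀ y, H ((ℝ ∙ n)ᗮ.reflection y) = H y) (y : E3) :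
    horizonProfile l H 0 ((ℝ ∙ n)ᗮ.reflection y) = (ℝ ∙ n)ᗮ.reflection (horizonProfile l H 0 y) := by
  unfold horizonProfile
  -- the potential field `F = (r^{1-l} H) y` is even
  have hF : ∀ z : E3, (‖(ℝ ∙ n)ᗮ.reflection z - 0‖ ^ ((1 : ℤ) - l) * H ((ℝ ∙ n)ᗮ.reflection z - 0))
        • ((ℝ ∙ n)ᗮ.reflection z - 0)
      = (ℝ ∙ n)ᗮ.reflection ((‖z - 0‖ ^ ((1 : ℤ) - l) * H (z - 0)) • (z - 0)) := by
    intro z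
    rw [sub_zero, sub_zero, LinearIsometryEquiv.norm_map, hH, LinearIsometryEquiv.map_smul]
  -- `curl F` is odd, `curl curl F` is even
  have hcurlF := curl_mirror_of_even hn
    (V := fun z : E3 => (‖z - 0‖ ^ ((1 : ℤ) - l) * H (z - 0)) • (z - 0)) hF
  exact curl_mirror_of_odd hn
    (V := curl (fun z : E3 => (‖z - 0‖ ^ ((1 : ℤ) - l) * H (z - 0)) • (z - 0))) hcurlF y

/-- **`𝔏₂` vanishes on the mirror plane for mirror-even fields**: if `U (S y) = S (U y)` for all `y` and `S x = x`, then
`horizonL2 U 0 x = 0` — both curls in `𝔏₂[U] = r²⟪y, curl((U×Ω)×Ω) + curl(U×curl(U×Ω))⟫` are mirror-odd. -/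
theorem horizonL2_eq_zero_of_mirror_even (hn : ‖n‖ = 1) {U : E3 → E3}
    (hU : ∀ y, U ((ℝ ∙ n)ᗮ.reflection y) = (ℝ ∙ n)ᗮ.reflection (U y)) {x : E3}
    (hx : (ℝ ∙ n)ᗮ.reflection x = x) : horizonL2 U 0 x = 0 := by
  -- `Ω = curl U` is odd
  have hΩ : ∀ y, curl U ((ℝ ∙ n)ᗮ.reflection y) = -(ℝ ∙ n)ᗮ.reflection (curl U y) :=
    curl_mirror_of_even hn (V := U) hU
  -- `A = U × Ω` is even
  have hA : ∀ y, cross (U ((ℝ ∙ n)ᗮ.reflection y)) (curl U ((ℝ ∙ n)ᗮ.reflection y))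
      = (ℝ ∙ n)ᗮ.reflection (cross (U y) (curl U y)) :=
    fun y => cross_mirror_even_odd hn (V := U) (W := curl U) hU hΩ y
  -- `B = A × Ω` is even, so `curl B` is odd
  have hB : ∀ y, cross (cross (U ((ℝ ∙ n)ᗮ.reflection y)) (curl U ((ℝ ∙ n)ᗮ.reflection y)))
        (curl U ((ℝ ∙ n)ᗮ.reflection y))
      = (ℝ ∙ n)ᗮ.reflection (cross (cross (U y) (curl U y)) (curl U y)) :=
    fun y => cross_mirror_even_odd hn (V := fun z => cross (U z) (curl U z)) (W := curl U) hA hΩ y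
  have hcurlB := curl_mirror_of_even hn
    (V := fun z => cross (cross (U z) (curl U z)) (curl U z)) hB x
  -- `C = curl A` is odd, `D = U × C` is even, so `curl D` is odd
  have hC : ∀ y, curl (fun z => cross (U z) (curl U z)) ((ℝ ∙ n)ᗮ.reflection y)
      = -(ℝ ∙ n)ᗮ.reflection (curl (fun z => cross (U z) (curl U z)) y) :=
    curl_mirror_of_even hn (V := fun z => cross (U z) (curl U z)) hA
  have hD : ∀ y, cross (U ((ℝ ∙ n)ᗮ.reflection y))
        (curl (fun w => cross (U w) (curl U w)) ((ℝ ∙ n)ᗮ.reflection y))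
      = (ℝ ∙ n)ᗮ.reflection (cross (U y) (curl (fun w => cross (U w) (curl U w)) y)) :=
    fun y => cross_mirror_even_odd hn (V := U) (W := curl (fun w => cross (U w) (curl U w))) hU hC y
  have hcurlD := curl_mirror_of_even hn
    (V := fun z => cross (U z) (curl (fun w => cross (U w) (curl U w)) z)) hD x
  rw [hx] at hcurlB hcurlD
  -- the sum of the two curls is odd at the fixed point `x`
  have hsum : (ℝ ∙ n)ᗮ.reflection
      (curl (fun z => cross (cross (U z) (curl U z)) (curl U z)) x
        + curl (fun z => cross (U z) (curl (fun w => cross (U w) (curl U w)) z)) x)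
      = -(curl (fun z => cross (cross (U z) (curl U z)) (curl U z)) x
        + curl (fun z => cross (U z) (curl (fun w => cross (U w) (curl U w)) z)) x) := by
    have h1 := congrArg ((ℝ ∙ n)ᗮ.reflection) hcurlB
    have h2 := congrArg ((ℝ ∙ n)ᗮ.reflection) hcurlD
    rw [map_neg, Submodule.reflection_reflection] at h1 h2
    rw [map_add, h1, h2, neg_add]
  unfold horizonL2
  rw [sub_zero, inner_eq_zero_of_mirror_odd_at hx hsum, mul_zero]

end Parity

/-! ### The table cell `HorizonL2Zonal` -/

/-- For any two vectors of `ℝ³` there is a unit vector orthogonal to both. -/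
theorem exists_unit_orthogonal_pair (a x : E3) : ∃ n : E3, ‖n‖ = 1 ∧ ⟪n, a⟫ = 0 ∧ ⟪n, x⟫ = 0 := by
  set K : Submodule ℝ E3 := Submodule.span ℝ (({a, x} : Finset E3) : Set E3) with hK
  have hKle : finrank ℝ K ≤ 2 :=
    (finrank_span_finset_le_card ({a, x} : Finset E3)).trans (Finset.card_le_two)
  have hbot : Kᗮ ≠ ⊥ := by
    intro h
    have h1 := Submodule.finrank_add_finrank_orthogonal K
    rw [h, finrank_bot, add_zero, finrank_euclideanSpace_fin] at h1
    omega
  obtain ⟨w, hwK, hw⟩ := Submodule.exists_mem_ne_zero_of_ne_bot hbot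
  have haK : a ∈ K := Submodule.subset_span (by simp)
  have hxK : x ∈ K := Submodule.subset_span (by simp)
  have hwa : ⟪a, w⟫ = 0 := Submodule.inner_right_of_mem_orthogonal haK hwK
  have hwx : ⟪x, w⟫ = 0 := Submodule.inner_right_of_mem_orthogonal hxK hwK
  refine ⟨(‖w‖⁻¹ : ℝ) • w, norm_smul_inv_norm hw, ?_, ?_⟩
  · rw [real_inner_smul_left, real_inner_comm, hwa, mul_zero]
  · rw [real_inner_smul_left, real_inner_comm, hwx, mul_zero]

/-- ★ **The table cell `HorizonL2Zonal` BY NAME** (all degrees): zonal profiles are annihilated by the order-two horizon law —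
for `l ≥ 2`, `a ≠ 0`, smooth `g` with `H(z) = ‖z‖^l g(⟪a,z⟫/‖z‖)` harmonic, `𝔏₂[U_H](x) = 0` for every `x ≠ 0`.
(Reflection parity: axisymmetric-without-swirl far fields never thread.  The hypotheses `2 ≤ l`, `a ≠ 0`, smoothness and
harmonicity are not needed by the argument.) -/
theorem horizonL2Zonal : HorizonL2Zonal := by
  intro l a g _hl _ha _hg _hharm x _hx
  obtain ⟨n, hn, hna, hnx⟩ := exists_unit_orthogonal_pair a x
  have hSa : (ℝ ∙ n)ᗮ.reflection a = a := mirror_apply_of_inner_eq_zero hn hna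
  have hSx : (ℝ ∙ n)ᗮ.reflection x = x := mirror_apply_of_inner_eq_zero hn hnx
  -- the zonal scalar is mirror-invariant
  have hH : ∀ y, (fun z : E3 => ‖z‖ ^ l * g (inner ℝ a z / ‖z‖)) ((ℝ ∙ n)ᗮ.reflection y)
      = (fun z : E3 => ‖z‖ ^ l * g (inner ℝ a z / ‖z‖)) y := by
    intro y
    have hin : inner ℝ a ((ℝ ∙ n)ᗮ.reflection y) = inner ℝ a y := by
      rw [← ((ℝ ∙ n)ᗮ.reflection).inner_map_map a y, hSa]
    simp only [LinearIsometryEquiv.norm_map, hin]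
  exact horizonL2_eq_zero_of_mirror_even hn (horizonProfile_mirror_even hn hH) hSx

end Summit.NavierStokesRegularity.NavierStokesRegularity.Theorems.PoloidalLiouville.HorizonTower

end
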